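import Literature.Analysis.FluidPDE.DuchonRobertCubicIdentity
import Literature.Analysis.FluidPDE.DuchonRobertSymmTestFieldProofs
import Literature.Analysis.FluidPDE.DuchonRobertUniformDefectOfEuler
import Literature.Analysis.FluidPDE.EnergyFluxMollifiedTest
import Literature.Analysis.FluidPDE.CoarseGrainingEstimates
import HarnessLib

/-!
# The symmetric Duchon–Robert commutator identity at a fixed mollification scale

Analysis/FluidPDE support file (theorem-only; serves the discharge of De Rosa–Isett's Eulerian
intermittency theorem, `Literature.Barriers.AnomalousDissipation.DeRosaIsett2024_thm27`, through
its step fact `DeRosaIsett2024_s51_finalBound`). For a distributional Euler solution `(u, p)` on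
`T^d × (0,T)` with `u ∈ L³_{t,x}`, `p ∈ L^{3/2}_{t,x}`, the torus mollifier `K = k_ε`
(`Torus.kernel ε`, `0 < ε ≤ 1/4`) and a scalar test function `ψ` supported in `(0,T)`, the local
energy flux `𝓔 = Torus.energyFluxFunctional T u p` satisfies the **exact identity**

`2 (𝓔(ψ) + 𝓔(ψ ⋆ₓ K)) = ∫∫ 𝒟_K(u) ψ + ∫∫ ω_K(u) (∂ₜψ + ⟪u, ∇ψ⟫) + 2 ∫∫ ⟪𝒞_K(p,u), ∇ψ⟫`

(`Torus.two_mul_energyFlux_add_energyFlux_mollified_eq`), where `(ψ ⋆ₓ K)(t) = ψ(t) ⋆ K`,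
`𝒟_K = Torus.kernelFlux K` is Duchon–Robert's flux through the kernel,
`ω_K(u) = |u|² + |u|² ⋆ K − 2⟪u, u ⋆ K⟫` (`= ∫ K(y)|u(· − y) − u|² dy`, the quadratic increment
average) and `𝒞_K(p,u) = (pu) ⋆ K + p u − p (u ⋆ K) − (p ⋆ K) u`
(`= ∫ K(y) δ_{-y}p δ_{-y}u dy`, the Constantin–E–Titi pressure–velocity remainder, by
`Torus.convolution_mul_sub_mul_convolution`). All integrals on the right are product integrals
over `(0,T) × T^d`.

This is the fixed-`ε` content of De Rosa–Isett 2024, §5.1, (moll_local_energy)–(eul_all_terms)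
with Lemma 5.1 (the higher-order averaging of the cubic term), written for Duchon–Robert's
symmetric regularisation instead of Constantin–E–Titi's: it is obtained from the tree's two
discharged Duchon–Robert identities — the cubic identity `Torus.integral_kernelFlux_mul_eq_holds`
(`∫∫𝒟_Kψ = A − B + 2E − 2C`) and the tested momentum equation
`Torus.symmTestField_identity_holds` (`Tm + C + P = 0`) of `DuchonRobertLocalBalance` — by
evaluating `𝓔` on the mollified test (adjointness of `⋆ K`, `Torus.integral_mul_convolution_comm`),
computing the pressure pairing `P = ∫∫ p ⟪u ⋆ K, ∇ψ⟫ + ∫∫ (p ⋆ K)⟪u, ∇ψ⟫`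
(`Torus.divergence_symmTestField`) and regrouping:
`2𝓔(ψ) = ∫∫|u|²∂ₜψ + ∫∫|u|²⟪u,∇ψ⟫ + 2∫∫p⟪u,∇ψ⟫`,
`2𝓔(ψ ⋆ₓ K) = ∫∫(|u|² ⋆ K)∂ₜψ + A + 2∫∫⟪(pu) ⋆ K, ∇ψ⟫`, so that the time terms collect into
`∫∫ω_K ∂ₜψ`, the transport terms into `∫∫ω_K⟪u,∇ψ⟫` and the pressure terms into `2∫∫⟪𝒞_K,∇ψ⟫`.

## Contents

* slice identities: `Torus.integral_inner_vecConv_comm` (vector adjointness of `⋆ K`),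
  `Torus.integral_mollifiedFluxIntegrand_slice` (the flux integrand of `ψ ⋆ₓ K` at a fixed time);
  the pressure pairing at a fixed time is the tree's `Torus.integral_mul_divergence_symmTestField`
  (`DuchonRobertUniformDefectOfEuler`);
* integrability on `(0,T) × T^d` of the nine mollified product integrands involved
  (`Torus.symmCommutator_integrable`; the three un-mollified ones are the tree's
  `Torus.integrable_flux_pieces`), and the three pairings as product integrals
  (`Torus.integral_mul_divergence_symmTestField_spaceTime`,
  `Torus.energyFluxFunctional_mollified_eq`, `Torus.energyFluxFunctional_eq_split`);
* the identity `Torus.two_mul_energyFlux_add_energyFlux_mollified_eq`.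

## References

* L. De Rosa, P. Isett, Arch. Ration. Mech. Anal. 248 (2024), Paper No. 11 = arXiv:2212.08176,
  §5.1 (moll_local_energy), (eul_all_terms), Lemma 5.1. [DeRosaIsett2024]
* J. Duchon, R. Robert, Nonlinearity 13 (2000) 249–255, proof of Prop. 1 (the symmetric
  regularised balance "(NS)·u^ε + (NS^ε)·u"). [DuchonRobert2000]
* P. Constantin, W. E, E. S. Titi, Comm. Math. Phys. 165 (1994), (9)–(10). [ConstantinETiti1994]
-/

noncomputable section

open MeasureTheory TopologicalSpace Set Function Filter Metric
open _root_.Topology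
open scoped ENNReal NNReal Convolution InnerProductSpace RealInnerProductSpace

namespace Literature.Analysis.FluidPDE.Torus

variable {d : Type*} [Fintype d] [DecidableEq d]

/-! ## Slice identities -/

section Slice

variable {K : UnitAddTorus d → ℝ}

omit [DecidableEq d] in
/-- Components of the vector mollification `K ⋆ G` of a continuous field: `(K ⋆ G)(x)ᵢ = (Gᵢ ⋆ K)(x)`,
i.e. `K ⋆ G = vecConv G K` (Mathlib's `eval_integral_piLp` and commutativity of real
convolution on `T^d`). [folklore] -/
theorem convolution_eq_vecConv (hK : Continuous K) {G : UnitAddTorus d → EuclideanSpace ℝ d}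
    (hG : Continuous G) (x : UnitAddTorus d) : (K ⋆ G) x = vecConv G K x := by
  have hint : ∀ i, Integrable (fun y => (K y • G (x - y)) i) volume := fun i =>
    ((hK.smul (hG.comp (continuous_const.sub continuous_id))).integrable_unitAddTorus).eval_piLp i
  ext i
  rw [convolution_lsmul, eval_integral_piLp hint i, vecConv_apply,
    FunctionSpaces.Torus.convolution_comm_real, convolution_lsmul]
  refine integral_congr_ae (ae_of_all _ fun y => ?_)
  simp only [PiLp.smul_apply, smul_eq_mul]

omit [DecidableEq d] in
/-- **Vector adjointness of mollification by an even kernel**: `∫ ⟪F, vecConv G K⟫ = ∫ ⟪vecConv F K, G⟫`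
for `F ∈ L¹`, `G` continuous and a continuous even kernel `K` (componentwise
`Torus.integral_mul_convolution_comm`). [folklore] -/
theorem integral_inner_vecConv_comm (hK : Continuous K) (hKev : ∀ z, K (-z) = K z)
    {F G : UnitAddTorus d → EuclideanSpace ℝ d} (hF : Integrable F volume) (hG : Continuous G) :
    ∫ x, ⟪F x, vecConv G K x⟫ = ∫ x, ⟪vecConv F K x, G x⟫ := by
  have hFi : ∀ i, Integrable (fun y => F y i) volume := fun i => hF.eval_piLp i
  have hGi : ∀ i, Continuous fun y => G y i := fun i => (EuclideanSpace.proj (𝕜 := ℝ) i).continuous.comp hG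
  have hGKi : ∀ i, Continuous fun x => vecConv G K x i := fun i => by
    simp only [vecConv_apply]
    exact FunctionSpaces.Torus.continuous_convolution (hGi i).integrable_unitAddTorus hK
  have hFKi : ∀ i, Continuous fun x => vecConv F K x i := fun i => by
    simp only [vecConv_apply]
    exact FunctionSpaces.Torus.continuous_convolution (hFi i) hK
  have h1 : ∀ i, Integrable (fun x => F x i * vecConv G K x i) volume := fun i =>
    integrable_mul_continuous (hFi i) (hGKi i)
  have h2 : ∀ i, Integrable (fun x => vecConv F K x i * G x i) volume := fun i =>
    ((hFKi i).mul (hGi i)).integrable_unitAddTorus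
  simp_rw [PiLp.inner_apply, RCLike.inner_apply, conj_trivial]
  rw [integral_finsetSum _ fun i _ => ?_, integral_finsetSum _ fun i _ => ?_]
  · refine Finset.sum_congr rfl fun i _ => ?_
    have e1 : (fun x => vecConv G K x i * F x i) = fun x => F x i * ((fun y => G y i) ⋆ K) x := by
      funext x; rw [vecConv_apply, mul_comm]
    have e2 : (fun x => G x i * vecConv F K x i) = fun x => ((fun y => F y i) ⋆ K) x * G x i := by
      funext x; rw [vecConv_apply, mul_comm]
    rw [e1, e2]
    exact FunctionSpaces.Torus.integral_mul_convolution_comm (hFi i) (hGi i).integrable_unitAddTorus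
      hK hKev
  · simpa only [mul_comm] using h2 i
  · simpa only [mul_comm] using h1 i

variable {v : UnitAddTorus d → EuclideanSpace ℝ d} {π : UnitAddTorus d → ℝ}

omit [DecidableEq d] in
/-- **The flux integrand of a mollified test at a fixed time.** For `v` with `|v|², |v|³, |π||v|`
integrable, a continuous weight `b`, a continuous vector weight `G` and a continuous even kernel
`K`:
`∫ [½|v|²(K ⋆ b) + (½|v|² + π)⟪v, vecConv G K⟫] = ½∫(|v|² ⋆ K) b + ½∫⟪(|v|²v) ⋆ K, G⟫ + ∫⟪(πv) ⋆ K, G⟫`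
(adjointness of `⋆ K`, scalar and vector). [folklore] -/
theorem integral_mollifiedFluxIntegrand_slice (hK : Continuous K) (hKev : ∀ z, K (-z) = K z)
    (hvm : AEStronglyMeasurable v volume) (hv2 : Integrable (fun y => ‖v y‖ ^ 2) volume)
    (hv3 : Integrable (fun y => ‖v y‖ ^ 3) volume) (hπm : AEStronglyMeasurable π volume)
    (hπv : Integrable (fun y => ‖π y‖ * ‖v y‖) volume)
    {b : UnitAddTorus d → ℝ} (hb : Continuous b) {G : UnitAddTorus d → EuclideanSpace ℝ d}
    (hG : Continuous G) :
    ∫ x, (2⁻¹ * ‖v x‖ ^ 2 * (K ⋆ b) x + (2⁻¹ * ‖v x‖ ^ 2 + π x) * ⟪v x, vecConv G K x⟫) =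
      2⁻¹ * (∫ x, ((fun y => ‖v y‖ ^ 2) ⋆ K) x * b x) +
        2⁻¹ * (∫ x, ⟪vecConv (fun y => ‖v y‖ ^ 2 • v y) K x, G x⟫) +
        ∫ x, ⟪vecConv (fun y => π y • v y) K x, G x⟫ := by
  -- integrability of the two fields `|v|² v`, `π v`
  have iF : Integrable (fun y => ‖v y‖ ^ 2 • v y) volume := by
    refine hv3.mono' ((hvm.norm.pow 2).smul hvm) (ae_of_all _ fun y => le_of_eq ?_)
    rw [norm_smul, Real.norm_eq_abs, abs_of_nonneg (sq_nonneg _)]; ring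
  have iH : Integrable (fun y => π y • v y) volume := by
    refine hπv.mono' (hπm.smul hvm) (ae_of_all _ fun y => le_of_eq ?_)
    rw [norm_smul]
  have hKb : Continuous (K ⋆ b) := by
    rw [← FunctionSpaces.Torus.convolution_comm_real]
    exact FunctionSpaces.Torus.continuous_convolution hb.integrable_unitAddTorus hK
  have hGK : Continuous (vecConv G K) := continuous_vecConv hG.integrable_unitAddTorus hK
  -- the three pieces of the left-hand side
  have i1 : Integrable (fun x => 2⁻¹ * ‖v x‖ ^ 2 * (K ⋆ b) x) volume := by
    have h := integrable_mul_continuous (hv2.const_mul 2⁻¹) hKb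
    exact h
  have i2 : Integrable (fun x => 2⁻¹ * ‖v x‖ ^ 2 * ⟪v x, vecConv G K x⟫) volume := by
    have h := integrable_inner_continuous (iF.smul (2⁻¹ : ℝ)) hGK
    refine h.congr (ae_of_all _ fun x => ?_)
    dsimp only [Pi.smul_apply]
    rw [real_inner_smul_left, real_inner_smul_left, mul_assoc]
  have i3 : Integrable (fun x => π x * ⟪v x, vecConv G K x⟫) volume := by
    have h := integrable_inner_continuous iH hGK
    refine h.congr (ae_of_all _ fun x => ?_)
    dsimp only
    rw [real_inner_smul_left]
  have hsplit : ∀ x, 2⁻¹ * ‖v x‖ ^ 2 * (K ⋆ b) x + (2⁻¹ * ‖v x‖ ^ 2 + π x) * ⟪v x, vecConv G K x⟫ =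
      2⁻¹ * ‖v x‖ ^ 2 * (K ⋆ b) x + 2⁻¹ * ‖v x‖ ^ 2 * ⟪v x, vecConv G K x⟫ +
        π x * ⟪v x, vecConv G K x⟫ := fun x => by ring
  have i12 : Integrable (fun x => 2⁻¹ * ‖v x‖ ^ 2 * (K ⋆ b) x +
      2⁻¹ * ‖v x‖ ^ 2 * ⟪v x, vecConv G K x⟫) volume := i1.add i2
  simp_rw [hsplit]
  rw [integral_add i12 i3, integral_add i1 i2]
  -- the time-derivative term
  have e1 : (∫ x, 2⁻¹ * ‖v x‖ ^ 2 * (K ⋆ b) x) = 2⁻¹ * ∫ x, ((fun y => ‖v y‖ ^ 2) ⋆ K) x * b x := by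
    rw [← FunctionSpaces.Torus.integral_mul_convolution_comm hv2 hb.integrable_unitAddTorus hK hKev,
      ← integral_const_mul, FunctionSpaces.Torus.convolution_comm_real b K]
    refine integral_congr_ae (ae_of_all _ fun x => ?_)
    dsimp only; ring
  -- the two gradient terms
  have e2 : (∫ x, 2⁻¹ * ‖v x‖ ^ 2 * ⟪v x, vecConv G K x⟫) =
      2⁻¹ * ∫ x, ⟪vecConv (fun y => ‖v y‖ ^ 2 • v y) K x, G x⟫ := by
    rw [← integral_inner_vecConv_comm hK hKev iF hG, ← integral_const_mul]
    refine integral_congr_ae (ae_of_all _ fun x => ?_)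
    dsimp only
    rw [real_inner_smul_left, mul_assoc]
  have e3 : (∫ x, π x * ⟪v x, vecConv G K x⟫) = ∫ x, ⟪vecConv (fun y => π y • v y) K x, G x⟫ := by
    rw [← integral_inner_vecConv_comm hK hKev iH hG]
    refine integral_congr_ae (ae_of_all _ fun x => ?_)
    dsimp only
    rw [real_inner_smul_left]
  rw [e1, e2, e3]

end Slice

/-! ## Hölder glue on a finite measure space: `L³ ⊂ L^{3/2}` -/

section Finite

variable {X : Type*} [MeasurableSpace X] {μ : Measure X} [IsFiniteMeasure μ]
  {F : Type*} [NormedAddCommGroup F]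

omit [Fintype d] [DecidableEq d] in
/-- On a finite measure space, `∫ |f|³ < ∞` implies `∫ |f|^{3/2} < ∞` (Mathlib's
`eLpNorm_le_eLpNorm_mul_rpow_measure_univ`). [folklore] -/
theorem lintegral_enorm_rpow_threeHalves_lt_top_of_three {f : X → F} (hf : AEStronglyMeasurable f μ)
    (h3 : ∫⁻ x, ‖f x‖ₑ ^ (3 : ℝ) ∂μ < ⊤) : ∫⁻ x, ‖f x‖ₑ ^ (3 / 2 : ℝ) ∂μ < ⊤ := by
  have h32 : ((3 : ℝ≥0∞) / 2).toReal = 3 / 2 := by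
    rw [ENNReal.toReal_div, ENNReal.toReal_ofNat, ENNReal.toReal_ofNat]
  have hne0 : (3 : ℝ≥0∞) / 2 ≠ 0 := (ENNReal.div_pos (by norm_num) (by norm_num)).ne'
  have hnet : (3 : ℝ≥0∞) / 2 ≠ ⊤ := ENNReal.div_ne_top (by norm_num) (by norm_num)
  have hle : (3 : ℝ≥0∞) / 2 ≤ 3 := by
    rw [ENNReal.div_le_iff (by norm_num) (by norm_num)]; norm_num
  have hL3 : eLpNorm f 3 μ < ⊤ := by
    rw [eLpNorm_lt_top_iff_lintegral_rpow_enorm_lt_top three_ne_zero ENNReal.ofNat_ne_top,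
      ENNReal.toReal_ofNat]
    exact h3
  have hL32 : eLpNorm f (3 / 2) μ < ⊤ := by
    refine lt_of_le_of_lt (eLpNorm_le_eLpNorm_mul_rpow_measure_univ hle hf) ?_
    refine ENNReal.mul_lt_top hL3 (ENNReal.rpow_lt_top_of_nonneg ?_ (measure_ne_top _ _))
    rw [h32, ENNReal.toReal_ofNat]; norm_num
  have h := (eLpNorm_lt_top_iff_lintegral_rpow_enorm_lt_top hne0 hnet).1 hL32
  rwa [h32] at h

end Finite

/-! ## Integrability on `(0,T) × T^d` of the product integrands -/

section SpaceTime

variable {T ε : ℝ} {u : ℝ → UnitAddTorus d → EuclideanSpace ℝ d} {p : ℝ → UnitAddTorus d → ℝ}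
  {ψ : ℝ → UnitAddTorus d → ℝ}

omit [DecidableEq d] in
/-- The flat-strip time coordinate lies in `(0,T)` almost everywhere for the product measure.
[folklore] -/
theorem ae_fst_mem_Ioo (T : ℝ) :
    ∀ᵐ z ∂((volume.restrict (Ioo 0 T)).prod (volume : Measure (UnitAddTorus d))), z.1 ∈ Ioo 0 T := by
  rw [← volume_restrict_Ioo_prod_univ]
  filter_upwards [ae_restrict_mem (measurableSet_Ioo.prod MeasurableSet.univ)] with z hz
  exact hz.1

/-- **Integrability of the product integrands of the symmetric commutator identity.** For
`u ∈ L³((0,T) × T^d)`, `p ∈ L^{3/2}((0,T) × T^d)` (jointly measurable), the torus mollifier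
`K = kernel ε` (`0 < ε ≤ 1/4`) and a test function `ψ` supported in `(0,T)`, the following are
integrable on `(0,T) × T^d` (dominations by slice functionals of `|u|³`, `|u|²`, `|p||u|`, and
Hölder `3/2, 3` with Young's inequality on the product space):
`(|u|² ⋆ K)∂ₜψ`, `⟪(|u|²u) ⋆ K, ∇ψ⟫`, `⟪(pu) ⋆ K, ∇ψ⟫`, `(|u|² ⋆ K)⟪u,∇ψ⟫`, `⟪u,u ⋆ K⟫⟪u,∇ψ⟫`,
`⟪u,u ⋆ K⟫∂ₜψ`, `p⟪u ⋆ K, ∇ψ⟫`, `(p ⋆ K)⟪u,∇ψ⟫`, `𝒟_K(u)ψ`. [folklore] -/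
theorem symmCommutator_integrable
    (hum : AEStronglyMeasurable (uncurry u) ((volume.restrict (Ioo 0 T)).prod volume))
    (hu3 : ∫⁻ t in Ioo 0 T, ∫⁻ x, ‖u t x‖ₑ ^ 3 < ⊤)
    (hpm : AEStronglyMeasurable (uncurry p) ((volume.restrict (Ioo 0 T)).prod volume))
    (hp32 : ∫⁻ t in Ioo 0 T, ∫⁻ x, ‖p t x‖ₑ ^ (3 / 2 : ℝ) < ⊤)
    (hε : 0 < ε) (hε' : ε ≤ 1 / 4) (hψ : FunctionSpaces.Torus.IsSpaceTimeTestIoo T ψ) :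
    Integrable (fun z : ℝ × UnitAddTorus d =>
        ((fun y => ‖u z.1 y‖ ^ 2) ⋆ FunctionSpaces.Torus.kernel ε) z.2 *
          FunctionSpaces.Torus.timeDeriv ψ z.1 z.2) ((volume.restrict (Ioo 0 T)).prod volume) ∧
      Integrable (fun z : ℝ × UnitAddTorus d =>
        ⟪vecConv (fun y => ‖u z.1 y‖ ^ 2 • u z.1 y) (FunctionSpaces.Torus.kernel ε) z.2,
          FunctionSpaces.Torus.gradient (ψ z.1) z.2⟫) ((volume.restrict (Ioo 0 T)).prod volume) ∧
      Integrable (fun z : ℝ × UnitAddTorus d =>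
        ⟪vecConv (fun y => p z.1 y • u z.1 y) (FunctionSpaces.Torus.kernel ε) z.2,
          FunctionSpaces.Torus.gradient (ψ z.1) z.2⟫) ((volume.restrict (Ioo 0 T)).prod volume) ∧
      Integrable (fun z : ℝ × UnitAddTorus d =>
        ((fun y => ‖u z.1 y‖ ^ 2) ⋆ FunctionSpaces.Torus.kernel ε) z.2 *
          ⟪u z.1 z.2, FunctionSpaces.Torus.gradient (ψ z.1) z.2⟫) ((volume.restrict (Ioo 0 T)).prod volume) ∧
      Integrable (fun z : ℝ × UnitAddTorus d =>
        ⟪u z.1 z.2, vecConv (u z.1) (FunctionSpaces.Torus.kernel ε) z.2⟫ *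
          ⟪u z.1 z.2, FunctionSpaces.Torus.gradient (ψ z.1) z.2⟫) ((volume.restrict (Ioo 0 T)).prod volume) ∧
      Integrable (fun z : ℝ × UnitAddTorus d =>
        ⟪u z.1 z.2, vecConv (u z.1) (FunctionSpaces.Torus.kernel ε) z.2⟫ *
          FunctionSpaces.Torus.timeDeriv ψ z.1 z.2) ((volume.restrict (Ioo 0 T)).prod volume) ∧
      Integrable (fun z : ℝ × UnitAddTorus d =>
        p z.1 z.2 * ⟪vecConv (u z.1) (FunctionSpaces.Torus.kernel ε) z.2,
          FunctionSpaces.Torus.gradient (ψ z.1) z.2⟫) ((volume.restrict (Ioo 0 T)).prod volume) ∧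
      Integrable (fun z : ℝ × UnitAddTorus d =>
        (p z.1 ⋆ FunctionSpaces.Torus.kernel ε) z.2 *
          ⟪u z.1 z.2, FunctionSpaces.Torus.gradient (ψ z.1) z.2⟫) ((volume.restrict (Ioo 0 T)).prod volume) ∧
      Integrable (fun z : ℝ × UnitAddTorus d =>
        kernelFlux (FunctionSpaces.Torus.kernel ε) (u z.1) z.2 * ψ z.1 z.2)
        ((volume.restrict (Ioo 0 T)).prod volume) := by
  set μ : Measure ℝ := volume.restrict (Ioo 0 T) with hμ
  set μT := μ.prod (volume : Measure (UnitAddTorus d)) with hμT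
  set K := FunctionSpaces.Torus.kernel (d := d) ε with hKdef
  have hK : FunctionSpaces.Torus.IsSmooth K := FunctionSpaces.Torus.isSmooth_kernel hε hε'
  have hKc : Continuous K := hK.continuous
  have hK0 : ∀ y, 0 ≤ K y := FunctionSpaces.Torus.kernel_nonneg hε.le
  have hK1 : ∫ y, K y = 1 := FunctionSpaces.Torus.integral_kernel hε hε'
  obtain ⟨CK, hCK⟩ := FunctionSpaces.Torus.exists_forall_norm_le_of_continuous hKc
  obtain ⟨CK', hCK'⟩ := FunctionSpaces.Torus.exists_forall_norm_le_of_continuous hK.gradient.continuous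
  have hCK0 : 0 ≤ CK := (norm_nonneg _).trans (hCK 0)
  -- test data
  obtain ⟨hψs, hdt, hgr, -⟩ := hψ.isSpaceTimeTest.isSmoothSpaceTimeOn_derived
  obtain ⟨⟨Cψ, hCψ0, hCψ⟩, hψm⟩ := hψs.bound_and_measurable T
  obtain ⟨⟨Cdt, hCdt0, hCdt⟩, hdtm⟩ := hdt.bound_and_measurable T
  obtain ⟨⟨Cg, hCg0, hCg⟩, hgm⟩ := hgr.bound_and_measurable T
  have hIoo : ∀ᵐ z ∂μT, z.1 ∈ Ioo 0 T := ae_fst_mem_Ioo T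
  have hdtb : ∀ᵐ z ∂μT, ‖FunctionSpaces.Torus.timeDeriv ψ z.1 z.2‖ ≤ Cdt :=
    hIoo.mono fun z hz => hCdt z.1 (Ioo_subset_Icc_self hz) z.2
  have hgrb : ∀ᵐ z ∂μT, ‖FunctionSpaces.Torus.gradient (ψ z.1) z.2‖ ≤ Cg :=
    hIoo.mono fun z hz => hCg z.1 (Ioo_subset_Icc_self hz) z.2
  -- slices and dominations
  have hslice3 : ∀ᵐ t ∂μ, MemLp (u t) 3 volume := ae_memLp_three_of_lintegral hum hu3
  have hgood : ∀ᵐ z ∂μT, MemLp (u z.1) 3 volume :=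
    ae_prod_of_ae_left (hslice3.mono fun t ht => fun _ => ht)
  obtain ⟨D1, D2, D3⟩ := integrable_slice_dominations hum hu3
  obtain ⟨I2, I3, Iqv⟩ := integrable_normSq_normCube_norm_mul hum hu3 hpm hp32
  have D0 : Integrable (fun z : ℝ × UnitAddTorus d => ∫ y, ‖u z.1 y‖ ^ 2) μT :=
    I2.integral_prod_left.comp_fst volume
  have DQ : Integrable (fun z : ℝ × UnitAddTorus d => ∫ y, ‖p z.1 y‖ * ‖u z.1 y‖) μT :=
    Iqv.integral_prod_left.comp_fst volume
  have hslicePU : ∀ᵐ t ∂μ, Integrable (fun y => ‖p t y‖ * ‖u t y‖) volume := Iqv.prod_right_ae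
  have hgoodPU : ∀ᵐ z ∂μT, Integrable (fun y => ‖p z.1 y‖ * ‖u z.1 y‖) volume :=
    ae_prod_of_ae_left (hslicePU.mono fun t ht => fun _ => ht)
  have hsliceP : ∀ᵐ t ∂μ, AEStronglyMeasurable (p t) volume := hpm.prodMk_left
  have hgoodP : ∀ᵐ z ∂μT, AEStronglyMeasurable (p z.1) volume :=
    ae_prod_of_ae_left (hsliceP.mono fun t ht => fun _ => ht)
  -- finiteness in product form
  have hU3 : ∫⁻ z, ‖u z.1 z.2‖ₑ ^ (3 : ℝ) ∂μT < ⊤ := by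
    have e : ∫⁻ t in Ioo 0 T, ∫⁻ x, ‖u t x‖ₑ ^ (3 : ℝ) = ∫⁻ z, ‖u z.1 z.2‖ₑ ^ (3 : ℝ) ∂μT :=
      lintegral_Ioo_lintegral_eq_lintegral_prod (hum.enorm.pow_const _)
    rw [← e]
    simpa only [ENNReal.rpow_ofNat] using hu3
  have hP32 : ∫⁻ z, ‖p z.1 z.2‖ₑ ^ (3 / 2 : ℝ) ∂μT < ⊤ := by
    have e : ∫⁻ t in Ioo 0 T, ∫⁻ x, ‖p t x‖ₑ ^ (3 / 2 : ℝ) = ∫⁻ z, ‖p z.1 z.2‖ₑ ^ (3 / 2 : ℝ) ∂μT :=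
      lintegral_Ioo_lintegral_eq_lintegral_prod (hpm.enorm.pow_const _)
    rw [← e]
    exact hp32
  -- components, the scalar `g = ⟪u, ∇ψ⟫`, and the mollified scalar fields
  set ui : d → ℝ → UnitAddTorus d → ℝ := fun i t x => u t x i with hui
  set g : ℝ → UnitAddTorus d → ℝ := fun t x => ⟪u t x, FunctionSpaces.Torus.gradient (ψ t) x⟫ with hg
  have hui_m : ∀ i, AEStronglyMeasurable (uncurry (ui i)) μT := fun i =>
    aestronglyMeasurable_uncurry_apply hum i
  have hg_m : AEStronglyMeasurable (uncurry g) μT := hum.inner hgm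
  have hui_3 : ∀ i, ∫⁻ z, ‖ui i z.1 z.2‖ₑ ^ (3 : ℝ) ∂μT < ⊤ := by
    intro i
    refine lt_of_le_of_lt ?_ hU3
    refine lintegral_mono fun z => ENNReal.rpow_le_rpow ?_ (by norm_num)
    rw [← ofReal_norm, ← ofReal_norm]
    exact ENNReal.ofReal_le_ofReal (PiLp.norm_apply_le (u z.1 z.2) i)
  have hg_3 : ∫⁻ z, ‖g z.1 z.2‖ₑ ^ (3 : ℝ) ∂μT < ⊤ := by
    have hb : ∀ᵐ z ∂μT, ‖g z.1 z.2‖ ≤ Cg * ‖u z.1 z.2‖ := hgrb.mono fun z hz => by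
      rw [hg]
      calc ‖⟪u z.1 z.2, FunctionSpaces.Torus.gradient (ψ z.1) z.2⟫‖
          ≤ ‖u z.1 z.2‖ * ‖FunctionSpaces.Torus.gradient (ψ z.1) z.2‖ := norm_inner_le_norm _ _
        _ ≤ ‖u z.1 z.2‖ * Cg := mul_le_mul_of_nonneg_left hz (norm_nonneg _)
        _ = Cg * ‖u z.1 z.2‖ := mul_comm _ _
    refine lt_of_le_of_lt (lintegral_rpow_enorm_le_of_norm_le hCg0 hb (by norm_num)) ?_
    exact ENNReal.mul_lt_top (ENNReal.rpow_lt_top_of_nonneg (by norm_num) ENNReal.ofReal_ne_top) hU3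
  have hconv_m : ∀ i, AEStronglyMeasurable (uncurry fun t x => (ui i t ⋆ K) x) μT := fun i =>
    FunctionSpaces.Torus.aestronglyMeasurable_uncurry_convolution _ (hui_m i) hKc
  have hconv_3 : ∀ i, ∫⁻ z, ‖(ui i z.1 ⋆ K) z.2‖ₑ ^ (3 : ℝ) ∂μT < ⊤ := fun i =>
    lt_of_le_of_lt (FunctionSpaces.Torus.lintegral_prod_rpow_enorm_convolution_le (hui_m i) hKc hK0
      hK1 (by norm_num)) (hui_3 i)
  have hpK_m : AEStronglyMeasurable (uncurry fun t x => (p t ⋆ K) x) μT :=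
    FunctionSpaces.Torus.aestronglyMeasurable_uncurry_convolution _ hpm hKc
  have hpK_32 : ∫⁻ z, ‖(p z.1 ⋆ K) z.2‖ₑ ^ (3 / 2 : ℝ) ∂μT < ⊤ :=
    lt_of_le_of_lt (FunctionSpaces.Torus.lintegral_prod_rpow_enorm_convolution_le hpm hKc hK0 hK1
      (by norm_num)) hP32
  -- the pointwise expansion `⟪vecConv v K x, w⟫ = ∑ᵢ (vᵢ ⋆ K)(x) wᵢ`
  have hinner : ∀ (t : ℝ) (x : UnitAddTorus d) (w : EuclideanSpace ℝ d),
      ⟪vecConv (u t) K x, w⟫ = ∑ i, (ui i t ⋆ K) x * w i := fun t x w => by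
    rw [PiLp.inner_apply]
    refine Finset.sum_congr rfl fun i _ => ?_
    rw [RCLike.inner_apply, conj_trivial, vecConv_apply, mul_comm]
  have hinner' : ∀ (t : ℝ) (x : UnitAddTorus d) (w : EuclideanSpace ℝ d),
      ⟪w, vecConv (u t) K x⟫ = ∑ i, w i * (ui i t ⋆ K) x := fun t x w => by
    rw [real_inner_comm, hinner]
    exact Finset.sum_congr rfl fun i _ => mul_comm _ _
  -- measurability of the vector mollifications
  have mUK : AEStronglyMeasurable (uncurry fun t x => vecConv (u t) K x) μT :=
    aestronglyMeasurable_uncurry_vecConv hum hKc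
  have hG2 : AEStronglyMeasurable (uncurry fun t y => ‖u t y‖ ^ 2 • u t y) μT := (hum.norm.pow 2).smul hum
  have hΘ : AEStronglyMeasurable (uncurry fun t y => ‖u t y‖ ^ 2) μT := hum.norm.pow 2
  have hPU : AEStronglyMeasurable (uncurry fun t y => p t y • u t y) μT := hpm.smul hum
  have mΘK : AEStronglyMeasurable (fun z : ℝ × UnitAddTorus d => ((fun y => ‖u z.1 y‖ ^ 2) ⋆ K) z.2) μT :=
    FunctionSpaces.Torus.aestronglyMeasurable_uncurry_convolution (ContinuousLinearMap.lsmul ℝ ℝ) hΘ hKc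
  refine ⟨?_, ?_, ?_, ?_, ?_, ?_, ?_, ?_, ?_⟩
  · -- `(|u|² ⋆ K) ∂ₜψ`
    refine (D0.const_mul (CK * Cdt)).mono' (mΘK.mul hdtm) ?_
    filter_upwards [hdtb, hgood] with z hz ht
    obtain ⟨-, I2t, -⟩ := MemLp.integrable_norm_pow_three_and_sq ht
    have hconv : ‖((fun y => ‖u z.1 y‖ ^ 2) ⋆ K) z.2‖ ≤ CK * ∫ y, ‖u z.1 y‖ ^ 2 := by
      have h := FunctionSpaces.Torus.norm_convolution_le I2t hCK z.2
      have hn : ∫ y, ‖‖u z.1 y‖ ^ 2‖ = ∫ y, ‖u z.1 y‖ ^ 2 :=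
        integral_congr_ae (ae_of_all _ fun y => by
          dsimp only; rw [Real.norm_eq_abs, abs_of_nonneg (sq_nonneg _)])
      rwa [hn] at h
    have hN0 : 0 ≤ ∫ y, ‖u z.1 y‖ ^ 2 := integral_nonneg fun y => sq_nonneg _
    rw [norm_mul]
    calc ‖((fun y => ‖u z.1 y‖ ^ 2) ⋆ K) z.2‖ * ‖FunctionSpaces.Torus.timeDeriv ψ z.1 z.2‖
        ≤ (CK * ∫ y, ‖u z.1 y‖ ^ 2) * Cdt := mul_le_mul hconv hz (norm_nonneg _) (by positivity)
      _ = CK * Cdt * ∫ y, ‖u z.1 y‖ ^ 2 := by ring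
  · -- `⟪(|u|²u) ⋆ K, ∇ψ⟫`
    have mA : AEStronglyMeasurable (fun z : ℝ × UnitAddTorus d =>
        ⟪vecConv (fun y => ‖u z.1 y‖ ^ 2 • u z.1 y) K z.2, FunctionSpaces.Torus.gradient (ψ z.1) z.2⟫) μT :=
      (aestronglyMeasurable_uncurry_vecConv hG2 hKc).inner hgm
    refine (D1.const_mul (Fintype.card d * CK * Cg)).mono' mA ?_
    filter_upwards [hgrb, hgood] with z hz ht
    obtain ⟨I3t, -, -⟩ := MemLp.integrable_norm_pow_three_and_sq ht
    have iG : Integrable (fun y => ‖u z.1 y‖ ^ 2 • u z.1 y) volume := by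
      refine I3t.mono' ((ht.1.norm.pow 2).smul ht.1) (ae_of_all _ fun y => le_of_eq ?_)
      rw [norm_smul, Real.norm_eq_abs, abs_of_nonneg (sq_nonneg _)]
      ring
    have hnorm : ∫ y, ‖‖u z.1 y‖ ^ 2 • u z.1 y‖ = ∫ y, ‖u z.1 y‖ ^ 3 := by
      refine integral_congr_ae (ae_of_all _ fun y => ?_)
      dsimp only
      rw [norm_smul, Real.norm_eq_abs, abs_of_nonneg (sq_nonneg _)]
      ring
    have hv := norm_vecConv_le iG hCK z.2
    rw [hnorm] at hv
    calc ‖⟪vecConv (fun y => ‖u z.1 y‖ ^ 2 • u z.1 y) K z.2, FunctionSpaces.Torus.gradient (ψ z.1) z.2⟫‖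
        ≤ ‖vecConv (fun y => ‖u z.1 y‖ ^ 2 • u z.1 y) K z.2‖ * ‖FunctionSpaces.Torus.gradient (ψ z.1) z.2‖ :=
          norm_inner_le_norm _ _
      _ ≤ (Fintype.card d * (CK * ∫ y, ‖u z.1 y‖ ^ 3)) * Cg :=
          mul_le_mul hv hz (norm_nonneg _) (by positivity)
      _ = Fintype.card d * CK * Cg * ∫ y, ‖u z.1 y‖ ^ 3 := by ring
  · -- `⟪(pu) ⋆ K, ∇ψ⟫`
    have mQ : AEStronglyMeasurable (fun z : ℝ × UnitAddTorus d =>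
        ⟪vecConv (fun y => p z.1 y • u z.1 y) K z.2, FunctionSpaces.Torus.gradient (ψ z.1) z.2⟫) μT :=
      (aestronglyMeasurable_uncurry_vecConv hPU hKc).inner hgm
    refine (DQ.const_mul (Fintype.card d * CK * Cg)).mono' mQ ?_
    filter_upwards [hgrb, hgood, hgoodPU, hgoodP] with z hz ht hpu hpmz
    have iH : Integrable (fun y => p z.1 y • u z.1 y) volume := by
      refine hpu.mono' (hpmz.smul ht.1) (ae_of_all _ fun y => le_of_eq ?_)
      rw [norm_smul]
    have hnorm : ∫ y, ‖p z.1 y • u z.1 y‖ = ∫ y, ‖p z.1 y‖ * ‖u z.1 y‖ :=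
      integral_congr_ae (ae_of_all _ fun y => by dsimp only; rw [norm_smul])
    have hv := norm_vecConv_le iH hCK z.2
    rw [hnorm] at hv
    have hN0 : 0 ≤ ∫ y, ‖p z.1 y‖ * ‖u z.1 y‖ := integral_nonneg fun y => by positivity
    calc ‖⟪vecConv (fun y => p z.1 y • u z.1 y) K z.2, FunctionSpaces.Torus.gradient (ψ z.1) z.2⟫‖
        ≤ ‖vecConv (fun y => p z.1 y • u z.1 y) K z.2‖ * ‖FunctionSpaces.Torus.gradient (ψ z.1) z.2‖ :=
          norm_inner_le_norm _ _
      _ ≤ (Fintype.card d * (CK * ∫ y, ‖p z.1 y‖ * ‖u z.1 y‖)) * Cg :=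
          mul_le_mul hv hz (norm_nonneg _) (by positivity)
      _ = Fintype.card d * CK * Cg * ∫ y, ‖p z.1 y‖ * ‖u z.1 y‖ := by ring
  · -- `(|u|² ⋆ K)⟪u, ∇ψ⟫`
    refine (D2.const_mul (CK * Cg)).mono' (mΘK.mul (hum.inner hgm)) ?_
    filter_upwards [hgrb, hgood] with z hz ht
    obtain ⟨-, I2t, -⟩ := MemLp.integrable_norm_pow_three_and_sq ht
    have hconv : ‖((fun y => ‖u z.1 y‖ ^ 2) ⋆ K) z.2‖ ≤ CK * ∫ y, ‖u z.1 y‖ ^ 2 := by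
      have h := FunctionSpaces.Torus.norm_convolution_le I2t hCK z.2
      have hn : ∫ y, ‖‖u z.1 y‖ ^ 2‖ = ∫ y, ‖u z.1 y‖ ^ 2 :=
        integral_congr_ae (ae_of_all _ fun y => by
          dsimp only; rw [Real.norm_eq_abs, abs_of_nonneg (sq_nonneg _)])
      rwa [hn] at h
    have hi : ‖⟪u z.1 z.2, FunctionSpaces.Torus.gradient (ψ z.1) z.2⟫‖ ≤ ‖u z.1 z.2‖ * Cg :=
      (norm_inner_le_norm _ _).trans (mul_le_mul_of_nonneg_left hz (norm_nonneg _))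
    have hN0 : 0 ≤ ∫ y, ‖u z.1 y‖ ^ 2 := integral_nonneg fun y => sq_nonneg _
    rw [norm_mul]
    calc ‖((fun y => ‖u z.1 y‖ ^ 2) ⋆ K) z.2‖ * ‖⟪u z.1 z.2, FunctionSpaces.Torus.gradient (ψ z.1) z.2⟫‖
        ≤ (CK * ∫ y, ‖u z.1 y‖ ^ 2) * (‖u z.1 z.2‖ * Cg) :=
          mul_le_mul hconv hi (norm_nonneg _) (by positivity)
      _ = CK * Cg * ((∫ y, ‖u z.1 y‖ ^ 2) * ‖u z.1 z.2‖) := by ring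
  · -- `⟪u, u ⋆ K⟫⟪u, ∇ψ⟫`
    refine (D3.const_mul (Fintype.card d * CK * Cg)).mono' ((hum.inner mUK).mul (hum.inner hgm)) ?_
    filter_upwards [hgrb, hgood] with z hz ht
    have hv := norm_vecConv_le (ht.integrable (by norm_num)) hCK z.2
    have hi : ‖⟪u z.1 z.2, FunctionSpaces.Torus.gradient (ψ z.1) z.2⟫‖ ≤ ‖u z.1 z.2‖ * Cg :=
      (norm_inner_le_norm _ _).trans (mul_le_mul_of_nonneg_left hz (norm_nonneg _))
    have h1 : ‖⟪u z.1 z.2, vecConv (u z.1) K z.2⟫‖ ≤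
        ‖u z.1 z.2‖ * (Fintype.card d * (CK * ∫ y, ‖u z.1 y‖)) :=
      (norm_inner_le_norm _ _).trans (mul_le_mul_of_nonneg_left hv (norm_nonneg _))
    have hN0 : 0 ≤ ∫ y, ‖u z.1 y‖ := integral_nonneg fun y => norm_nonneg _
    rw [norm_mul]
    calc ‖⟪u z.1 z.2, vecConv (u z.1) K z.2⟫‖ * ‖⟪u z.1 z.2, FunctionSpaces.Torus.gradient (ψ z.1) z.2⟫‖
        ≤ (‖u z.1 z.2‖ * (Fintype.card d * (CK * ∫ y, ‖u z.1 y‖))) * (‖u z.1 z.2‖ * Cg) :=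
          mul_le_mul h1 hi (norm_nonneg _) (by positivity)
      _ = Fintype.card d * CK * Cg * ((∫ y, ‖u z.1 y‖) * ‖u z.1 z.2‖ ^ 2) := by ring
  · -- `⟪u, u ⋆ K⟫∂ₜψ = ∑ᵢ (uᵢ ∂ₜψ)(uᵢ ⋆ K)`, Hölder `3/2, 3`
    have hterm : ∀ i, Integrable (fun z : ℝ × UnitAddTorus d =>
        (ui i z.1 z.2 * FunctionSpaces.Torus.timeDeriv ψ z.1 z.2) * (ui i z.1 ⋆ K) z.2) μT := by
      intro i
      refine integrable_mul_of_lintegral_rpow ((hui_m i).mul hdtm) (hconv_m i) ?_ (hconv_3 i)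
      have hb : ∀ᵐ z ∂μT, ‖ui i z.1 z.2 * FunctionSpaces.Torus.timeDeriv ψ z.1 z.2‖ ≤ Cdt * ‖ui i z.1 z.2‖ :=
        hdtb.mono fun z hz => by
          rw [norm_mul, mul_comm]
          exact mul_le_mul_of_nonneg_right hz (norm_nonneg _)
      refine lt_of_le_of_lt (lintegral_rpow_enorm_le_of_norm_le hCdt0 hb (by norm_num)) ?_
      exact ENNReal.mul_lt_top (ENNReal.rpow_lt_top_of_nonneg (by norm_num) ENNReal.ofReal_ne_top)
        (lintegral_enorm_rpow_threeHalves_lt_top_of_three (hui_m i) (hui_3 i))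
    refine (integrable_finsetSum Finset.univ fun i _ => hterm i).congr (ae_of_all _ fun z => ?_)
    dsimp only
    rw [hinner' z.1 z.2 (u z.1 z.2), Finset.sum_mul]
    refine Finset.sum_congr rfl fun i _ => ?_
    simp only [hui]
    ring
  · -- `p⟪u ⋆ K, ∇ψ⟫ = ∑ᵢ (p ∂ᵢψ)(uᵢ ⋆ K)`, Hölder `3/2, 3`
    have hgri_m : ∀ i, AEStronglyMeasurable
        (uncurry fun t x => FunctionSpaces.Torus.gradient (ψ t) x i) μT := fun i =>
      aestronglyMeasurable_uncurry_apply hgm i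
    have hterm : ∀ i, Integrable (fun z : ℝ × UnitAddTorus d =>
        (p z.1 z.2 * FunctionSpaces.Torus.gradient (ψ z.1) z.2 i) * (ui i z.1 ⋆ K) z.2) μT := by
      intro i
      refine integrable_mul_of_lintegral_rpow (hpm.mul (hgri_m i)) (hconv_m i) ?_ (hconv_3 i)
      have hb : ∀ᵐ z ∂μT, ‖p z.1 z.2 * FunctionSpaces.Torus.gradient (ψ z.1) z.2 i‖ ≤ Cg * ‖p z.1 z.2‖ :=
        hgrb.mono fun z hz => by
          rw [norm_mul]
          calc ‖p z.1 z.2‖ * ‖FunctionSpaces.Torus.gradient (ψ z.1) z.2 i‖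
              ≤ ‖p z.1 z.2‖ * Cg := mul_le_mul_of_nonneg_left
                ((PiLp.norm_apply_le (FunctionSpaces.Torus.gradient (ψ z.1) z.2) i).trans hz) (norm_nonneg _)
            _ = Cg * ‖p z.1 z.2‖ := mul_comm _ _
      refine lt_of_le_of_lt (lintegral_rpow_enorm_le_of_norm_le hCg0 hb (by norm_num)) ?_
      exact ENNReal.mul_lt_top (ENNReal.rpow_lt_top_of_nonneg (by norm_num) ENNReal.ofReal_ne_top) hP32
    refine (integrable_finsetSum Finset.univ fun i _ => hterm i).congr (ae_of_all _ fun z => ?_)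
    dsimp only
    rw [hinner z.1 z.2, Finset.mul_sum]
    refine Finset.sum_congr rfl fun i _ => ?_
    ring
  · -- `(p ⋆ K)⟪u, ∇ψ⟫`, Hölder `3/2, 3`
    exact integrable_mul_of_lintegral_rpow hpK_m hg_m hpK_32 hg_3
  · -- `𝒟_K(u) ψ`
    have I3' : Integrable (fun z : ℝ × UnitAddTorus d => ‖u z.1 z.2‖ ^ 3) μT := I3
    have mK : AEStronglyMeasurable (fun z : ℝ × UnitAddTorus d => kernelFlux K (u z.1) z.2 * ψ z.1 z.2) μT := by
      have hδ : AEStronglyMeasurable (fun q : (ℝ × UnitAddTorus d) × UnitAddTorus d =>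
          u q.1.1 (q.1.2 + q.2) - u q.1.1 q.1.2) (μT.prod volume) :=
        (aestronglyMeasurable_translate (ν := volume) hum measurable_id).sub hum.comp_fst
      have hΨ : AEStronglyMeasurable (fun q : (ℝ × UnitAddTorus d) × UnitAddTorus d =>
          ⟪FunctionSpaces.Torus.gradient K q.2, u q.1.1 (q.1.2 + q.2) - u q.1.1 q.1.2⟫ *
            ‖u q.1.1 (q.1.2 + q.2) - u q.1.1 q.1.2‖ ^ 2) (μT.prod volume) :=
        ((hK.gradient.continuous.aestronglyMeasurable.comp_snd).inner hδ).mul (hδ.norm.pow 2)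
      exact hΨ.integral_prod_right'.mul hψm
    refine ((D1.add I3').const_mul (4 * CK' * Cψ)).mono' mK ?_
    filter_upwards [hIoo, hgood] with z hz ht
    have hk := abs_kernelFlux_le ht hCK' z.2
    have hψz : ‖ψ z.1 z.2‖ ≤ Cψ := hCψ z.1 (Ioo_subset_Icc_self hz) z.2
    have hCK'0 : 0 ≤ CK' := (norm_nonneg _).trans (hCK' 0)
    have hN0 : 0 ≤ (∫ y, ‖u z.1 y‖ ^ 3) + ‖u z.1 z.2‖ ^ 3 :=
      add_nonneg (integral_nonneg fun y => pow_nonneg (norm_nonneg _) _) (pow_nonneg (norm_nonneg _) _)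
    rw [norm_mul, Real.norm_eq_abs]
    calc |kernelFlux K (u z.1) z.2| * ‖ψ z.1 z.2‖
        ≤ (4 * CK' * ((∫ y, ‖u z.1 y‖ ^ 3) + ‖u z.1 z.2‖ ^ 3)) * Cψ :=
          mul_le_mul hk hψz (norm_nonneg _) (by positivity)
      _ = 4 * CK' * Cψ * ((∫ y, ‖u z.1 y‖ ^ 3) + ‖u z.1 z.2‖ ^ 3) := by ring

end SpaceTime

/-! ## The three pairings as product integrals -/

section Pairings

variable {T ε : ℝ} {u : ℝ → UnitAddTorus d → EuclideanSpace ℝ d} {p : ℝ → UnitAddTorus d → ℝ}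
  {ψ : ℝ → UnitAddTorus d → ℝ}

/-- **The pressure pairing of the symmetric Duchon–Robert field, on `(0,T) × T^d`**:
`∫₀ᵀ∫ p div Φ_K = ∫∫ p⟪u ⋆ K, ∇ψ⟫ + ∫∫ (p ⋆ K)⟪u, ∇ψ⟫` (`Torus.integral_mul_divergence_symmTestField`
at a.e. time, then Fubini). [folklore] -/
theorem integral_mul_divergence_symmTestField_spaceTime
    (hum : AEStronglyMeasurable (uncurry u) ((volume.restrict (Ioo 0 T)).prod volume))
    (hu3 : ∫⁻ t in Ioo 0 T, ∫⁻ x, ‖u t x‖ₑ ^ 3 < ⊤)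
    (hdiv : ∀ᵐ t ∂(volume.restrict (Ioo 0 T)), FunctionSpaces.Torus.IsWeaklyDivFree (u t))
    (hpm : AEStronglyMeasurable (uncurry p) ((volume.restrict (Ioo 0 T)).prod volume))
    (hp32 : ∫⁻ t in Ioo 0 T, ∫⁻ x, ‖p t x‖ₑ ^ (3 / 2 : ℝ) < ⊤)
    (hε : 0 < ε) (hε' : ε ≤ 1 / 4) (hψ : FunctionSpaces.Torus.IsSpaceTimeTestIoo T ψ) :
    (∫ t in Ioo 0 T, ∫ x, p t x * FunctionSpaces.Torus.divergence
        (symmTestField (FunctionSpaces.Torus.kernel ε) (ψ t) (u t)) x) =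
      (∫ z, p z.1 z.2 * ⟪vecConv (u z.1) (FunctionSpaces.Torus.kernel ε) z.2,
          FunctionSpaces.Torus.gradient (ψ z.1) z.2⟫ ∂((volume.restrict (Ioo 0 T)).prod volume)) +
        ∫ z, (p z.1 ⋆ FunctionSpaces.Torus.kernel ε) z.2 *
          ⟪u z.1 z.2, FunctionSpaces.Torus.gradient (ψ z.1) z.2⟫ ∂((volume.restrict (Ioo 0 T)).prod volume) := by
  set μ : Measure ℝ := volume.restrict (Ioo 0 T) with hμ
  set μT := μ.prod (volume : Measure (UnitAddTorus d)) with hμT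
  obtain ⟨-, -, -, -, -, -, iP1, iP2, -⟩ := symmCommutator_integrable hum hu3 hpm hp32 hε hε' hψ
  set K := FunctionSpaces.Torus.kernel (d := d) ε with hKdef
  have hK : FunctionSpaces.Torus.IsSmooth K := FunctionSpaces.Torus.isSmooth_kernel hε hε'
  have hKev : ∀ z, K (-z) = K z := FunctionSpaces.Torus.kernel_neg hε hε'
  have hslice3 : ∀ᵐ t ∂μ, MemLp (u t) 3 volume := ae_memLp_three_of_lintegral hum hu3
  have hP32 : ∫⁻ z, ‖p z.1 z.2‖ₑ ^ (3 / 2 : ℝ) ∂μT < ⊤ := by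
    have e : ∫⁻ t in Ioo 0 T, ∫⁻ x, ‖p t x‖ₑ ^ (3 / 2 : ℝ) = ∫⁻ z, ‖p z.1 z.2‖ₑ ^ (3 / 2 : ℝ) ∂μT :=
      lintegral_Ioo_lintegral_eq_lintegral_prod (hpm.enorm.pow_const _)
    rw [← e]
    exact hp32
  have hsliceP : ∀ᵐ t ∂μ, Integrable (p t) volume := by
    have h := FunctionSpaces.Torus.ae_memLp_of_lintegral_prod_rpow_lt_top hpm
      (by norm_num : (0 : ℝ) < 3 / 2) hP32
    filter_upwards [h] with t ht
    refine ht.integrable ?_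
    rw [← ENNReal.ofReal_one]
    exact ENNReal.ofReal_le_ofReal (by norm_num)
  have hid : ∀ᵐ t ∂μ, (∫ x, p t x * FunctionSpaces.Torus.divergence (symmTestField K (ψ t) (u t)) x) =
      (∫ x, p t x * ⟪vecConv (u t) K x, FunctionSpaces.Torus.gradient (ψ t) x⟫) +
        ∫ x, (p t ⋆ K) x * ⟪u t x, FunctionSpaces.Torus.gradient (ψ t) x⟫ := by
    filter_upwards [hslice3, hdiv, hsliceP] with t ht hdt hpt
    exact integral_mul_divergence_symmTestField (ht.integrable (by norm_num)) hdt hpt hK hKev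
      (hψ.isSpaceTimeTest.isSmooth_slice t)
  have j1 : Integrable (fun t => ∫ x, p t x * ⟪vecConv (u t) K x, FunctionSpaces.Torus.gradient (ψ t) x⟫) μ :=
    iP1.integral_prod_left
  have j2 : Integrable (fun t => ∫ x, (p t ⋆ K) x * ⟪u t x, FunctionSpaces.Torus.gradient (ψ t) x⟫) μ :=
    iP2.integral_prod_left
  rw [integral_congr_ae hid, integral_add j1 j2, integral_prod _ iP1, integral_prod _ iP2]

/-- **The local energy flux of a slice-mollified test function, on `(0,T) × T^d`**:
`𝓔(ψ ⋆ₓ K) = ½∫∫(|u|² ⋆ K)∂ₜψ + ½∫∫⟪(|u|²u) ⋆ K, ∇ψ⟫ + ∫∫⟪(pu) ⋆ K, ∇ψ⟫`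
(`∂ₜ(ψ ⋆ₓ K) = K ⋆ ∂ₜψ`, `∇(ψ ⋆ₓ K) = vecConv (∇ψ) K`, then `Torus.integral_mollifiedFluxIntegrand_slice`
at a.e. time and Fubini). [folklore] -/
theorem energyFluxFunctional_mollified_eq
    (hum : AEStronglyMeasurable (uncurry u) ((volume.restrict (Ioo 0 T)).prod volume))
    (hu3 : ∫⁻ t in Ioo 0 T, ∫⁻ x, ‖u t x‖ₑ ^ 3 < ⊤)
    (hpm : AEStronglyMeasurable (uncurry p) ((volume.restrict (Ioo 0 T)).prod volume))
    (hp32 : ∫⁻ t in Ioo 0 T, ∫⁻ x, ‖p t x‖ₑ ^ (3 / 2 : ℝ) < ⊤)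
    (hε : 0 < ε) (hε' : ε ≤ 1 / 4) (hψ : FunctionSpaces.Torus.IsSpaceTimeTestIoo T ψ) :
    energyFluxFunctional T u p (fun t => ψ t ⋆ FunctionSpaces.Torus.kernel ε) =
      2⁻¹ * (∫ z, ((fun y => ‖u z.1 y‖ ^ 2) ⋆ FunctionSpaces.Torus.kernel ε) z.2 *
          FunctionSpaces.Torus.timeDeriv ψ z.1 z.2 ∂((volume.restrict (Ioo 0 T)).prod volume)) +
        2⁻¹ * (∫ z, ⟪vecConv (fun y => ‖u z.1 y‖ ^ 2 • u z.1 y) (FunctionSpaces.Torus.kernel ε) z.2,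
          FunctionSpaces.Torus.gradient (ψ z.1) z.2⟫ ∂((volume.restrict (Ioo 0 T)).prod volume)) +
        ∫ z, ⟪vecConv (fun y => p z.1 y • u z.1 y) (FunctionSpaces.Torus.kernel ε) z.2,
          FunctionSpaces.Torus.gradient (ψ z.1) z.2⟫ ∂((volume.restrict (Ioo 0 T)).prod volume) := by
  set μ : Measure ℝ := volume.restrict (Ioo 0 T) with hμ
  set μT := μ.prod (volume : Measure (UnitAddTorus d)) with hμT
  obtain ⟨iB0, iA, iQ, -, -, -, -, -, -⟩ := symmCommutator_integrable hum hu3 hpm hp32 hε hε' hψ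
  obtain ⟨-, -, Iqv⟩ := integrable_normSq_normCube_norm_mul hum hu3 hpm hp32
  set K := FunctionSpaces.Torus.kernel (d := d) ε with hKdef
  have hK : FunctionSpaces.Torus.IsSmooth K := FunctionSpaces.Torus.isSmooth_kernel hε hε'
  have hKc : Continuous K := hK.continuous
  have hKi : Integrable K volume := hKc.integrable_unitAddTorus
  have hKev : ∀ z, K (-z) = K z := FunctionSpaces.Torus.kernel_neg hε hε'
  have hslice3 : ∀ᵐ t ∂μ, MemLp (u t) 3 volume := ae_memLp_three_of_lintegral hum hu3
  have hslicePU : ∀ᵐ t ∂μ, Integrable (fun y => ‖p t y‖ * ‖u t y‖) volume := Iqv.prod_right_ae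
  have hsliceP : ∀ᵐ t ∂μ, AEStronglyMeasurable (p t) volume := hpm.prodMk_left
  -- the test data of the mollified test function
  obtain ⟨-, hdt, hgr, -⟩ := hψ.isSpaceTimeTest.isSmoothSpaceTimeOn_derived
  have hdtc : Continuous (uncurry (FunctionSpaces.Torus.timeDeriv ψ)) :=
    FunctionSpaces.Torus.continuous_uncurry_of_continuous_stLift hψ.isSpaceTimeTest.timeDeriv.1.continuous
  have hgrc : Continuous (uncurry fun t => FunctionSpaces.Torus.gradient (ψ t)) := by
    have h := hgr
    unfold FunctionSpaces.Torus.IsSmoothSpaceTimeOn at h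
    rw [univ_prod_univ, contDiffOn_univ] at h
    exact FunctionSpaces.Torus.continuous_uncurry_of_continuous_stLift h.continuous
  have hbt : ∀ t, Continuous (FunctionSpaces.Torus.timeDeriv ψ t) := fun t =>
    hdtc.comp (Continuous.prodMk_right t)
  have hGt : ∀ t, Continuous fun x => FunctionSpaces.Torus.gradient (ψ t) x := fun t =>
    hgrc.comp (Continuous.prodMk_right t)
  have hconv : (fun t => ψ t ⋆ K) = fun t => K ⋆ ψ t := conv_kernel_comm K ψ
  have hpt : ∀ t x,
      2⁻¹ * ‖u t x‖ ^ 2 * FunctionSpaces.Torus.timeDeriv (fun t => ψ t ⋆ K) t x +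
        (2⁻¹ * ‖u t x‖ ^ 2 + p t x) * ⟪u t x, FunctionSpaces.Torus.gradient ((fun t => ψ t ⋆ K) t) x⟫ =
      2⁻¹ * ‖u t x‖ ^ 2 * (K ⋆ FunctionSpaces.Torus.timeDeriv ψ t) x +
        (2⁻¹ * ‖u t x‖ ^ 2 + p t x) *
          ⟪u t x, vecConv (fun y => FunctionSpaces.Torus.gradient (ψ t) y) K x⟫ := by
    intro t x
    have h1 : FunctionSpaces.Torus.timeDeriv (fun t => ψ t ⋆ K) t x =
        (K ⋆ FunctionSpaces.Torus.timeDeriv ψ t) x := by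
      rw [hconv, timeDeriv_kernel_conv hψ.isSpaceTimeTest hKi]
    have h2 : FunctionSpaces.Torus.gradient ((fun t => ψ t ⋆ K) t) x =
        vecConv (fun y => FunctionSpaces.Torus.gradient (ψ t) y) K x := by
      rw [show (fun t => ψ t ⋆ K) t = K ⋆ ψ t from FunctionSpaces.Torus.convolution_comm_real _ _,
        FunctionSpaces.Torus.gradient_convolution hKi (hψ.isSpaceTimeTest.isSmooth_slice t) x,
        convolution_eq_vecConv hKc (hGt t) x]
    rw [h1, h2]
  have hid : ∀ᵐ t ∂μ, (∫ x,
      (2⁻¹ * ‖u t x‖ ^ 2 * FunctionSpaces.Torus.timeDeriv (fun t => ψ t ⋆ K) t x +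
        (2⁻¹ * ‖u t x‖ ^ 2 + p t x) *
          ⟪u t x, FunctionSpaces.Torus.gradient ((fun t => ψ t ⋆ K) t) x⟫)) =
      2⁻¹ * (∫ x, ((fun y => ‖u t y‖ ^ 2) ⋆ K) x * FunctionSpaces.Torus.timeDeriv ψ t x) +
        2⁻¹ * (∫ x, ⟪vecConv (fun y => ‖u t y‖ ^ 2 • u t y) K x, FunctionSpaces.Torus.gradient (ψ t) x⟫) +
        ∫ x, ⟪vecConv (fun y => p t y • u t y) K x, FunctionSpaces.Torus.gradient (ψ t) x⟫ := by
    filter_upwards [hslice3, hslicePU, hsliceP] with t ht hpu hptm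
    obtain ⟨I3t, I2t, -⟩ := MemLp.integrable_norm_pow_three_and_sq ht
    simp_rw [hpt t]
    exact integral_mollifiedFluxIntegrand_slice hKc hKev ht.1 I2t I3t hptm hpu (hbt t) (hGt t)
  rw [energyFluxFunctional_apply, integral_congr_ae hid]
  have j1 : Integrable (fun t => 2⁻¹ * ∫ x, ((fun y => ‖u t y‖ ^ 2) ⋆ K) x *
      FunctionSpaces.Torus.timeDeriv ψ t x) μ := iB0.integral_prod_left.const_mul _
  have j2 : Integrable (fun t => 2⁻¹ * ∫ x, ⟪vecConv (fun y => ‖u t y‖ ^ 2 • u t y) K x,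
      FunctionSpaces.Torus.gradient (ψ t) x⟫) μ := iA.integral_prod_left.const_mul _
  have j3 : Integrable (fun t => ∫ x, ⟪vecConv (fun y => p t y • u t y) K x,
      FunctionSpaces.Torus.gradient (ψ t) x⟫) μ := iQ.integral_prod_left
  have j12 : Integrable (fun t => 2⁻¹ * (∫ x, ((fun y => ‖u t y‖ ^ 2) ⋆ K) x *
      FunctionSpaces.Torus.timeDeriv ψ t x) + 2⁻¹ * ∫ x, ⟪vecConv (fun y => ‖u t y‖ ^ 2 • u t y) K x,
      FunctionSpaces.Torus.gradient (ψ t) x⟫) μ := j1.add j2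
  rw [integral_add j12 j3, integral_add j1 j2, integral_const_mul, integral_const_mul,
    integral_prod _ iB0, integral_prod _ iA, integral_prod _ iQ]

omit [DecidableEq d] in
/-- **The local energy flux on `(0,T) × T^d`, split**:
`𝓔(ψ) = ½∫∫|u|²∂ₜψ + ½∫∫|u|²⟪u,∇ψ⟫ + ∫∫p⟪u,∇ψ⟫`. [folklore] -/
theorem energyFluxFunctional_eq_split
    (hum : AEStronglyMeasurable (uncurry u) ((volume.restrict (Ioo 0 T)).prod volume))
    (hu3 : ∫⁻ t in Ioo 0 T, ∫⁻ x, ‖u t x‖ₑ ^ 3 < ⊤)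
    (hpm : AEStronglyMeasurable (uncurry p) ((volume.restrict (Ioo 0 T)).prod volume))
    (hp32 : ∫⁻ t in Ioo 0 T, ∫⁻ x, ‖p t x‖ₑ ^ (3 / 2 : ℝ) < ⊤)
    (hψ : FunctionSpaces.Torus.IsSpaceTimeTestIoo T ψ) :
    energyFluxFunctional T u p ψ =
      2⁻¹ * (∫ z, ‖u z.1 z.2‖ ^ 2 * FunctionSpaces.Torus.timeDeriv ψ z.1 z.2
          ∂((volume.restrict (Ioo 0 T)).prod volume)) +
        2⁻¹ * (∫ z, ‖u z.1 z.2‖ ^ 2 * ⟪u z.1 z.2, FunctionSpaces.Torus.gradient (ψ z.1) z.2⟫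
          ∂((volume.restrict (Ioo 0 T)).prod volume)) +
        ∫ z, p z.1 z.2 * ⟪u z.1 z.2, FunctionSpaces.Torus.gradient (ψ z.1) z.2⟫
          ∂((volume.restrict (Ioo 0 T)).prod volume) := by
  set μT := (volume.restrict (Ioo 0 T)).prod (volume : Measure (UnitAddTorus d)) with hμT
  obtain ⟨-, hdt, hgr, -⟩ := hψ.isSpaceTimeTest.isSmoothSpaceTimeOn_derived
  obtain ⟨⟨Cdt, -, hCdt⟩, hdtm⟩ := hdt.bound_and_measurable T
  obtain ⟨⟨Cgr, -, hCgr⟩, hgrm⟩ := hgr.bound_and_measurable T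
  have hu3' : ∫⁻ t in Ioo 0 T, ∫⁻ x, ‖u t x‖ₑ ^ (3 : ℕ) < ⊤ := hu3
  obtain ⟨IT, IA, IP⟩ := integrable_flux_pieces hum hu3' hpm hp32 hdtm hgrm (C := max Cdt Cgr)
    (fun t ht x => (hCdt t ht x).trans (le_max_left _ _))
    (fun t ht x => (hCgr t ht x).trans (le_max_right _ _))
  obtain ⟨-, e⟩ := energyFluxFunctional_eq_integral_prod (T := T) hum hu3' hpm hp32 hψ.isSpaceTimeTest
  rw [energyFluxFunctional_apply, e]
  have hpt : ∀ z : ℝ × UnitAddTorus d,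
      2⁻¹ * ‖u z.1 z.2‖ ^ 2 * FunctionSpaces.Torus.timeDeriv ψ z.1 z.2 +
        (2⁻¹ * ‖u z.1 z.2‖ ^ 2 + p z.1 z.2) * ⟪u z.1 z.2, FunctionSpaces.Torus.gradient (ψ z.1) z.2⟫ =
      2⁻¹ * (‖u z.1 z.2‖ ^ 2 * FunctionSpaces.Torus.timeDeriv ψ z.1 z.2) +
        2⁻¹ * (‖u z.1 z.2‖ ^ 2 * ⟪u z.1 z.2, FunctionSpaces.Torus.gradient (ψ z.1) z.2⟫) +
        p z.1 z.2 * ⟪u z.1 z.2, FunctionSpaces.Torus.gradient (ψ z.1) z.2⟫ := fun z => by ring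
  have J1 : Integrable (fun z : ℝ × UnitAddTorus d =>
      2⁻¹ * (‖u z.1 z.2‖ ^ 2 * FunctionSpaces.Torus.timeDeriv ψ z.1 z.2)) μT := IT.const_mul _
  have J2 : Integrable (fun z : ℝ × UnitAddTorus d =>
      2⁻¹ * (‖u z.1 z.2‖ ^ 2 * ⟪u z.1 z.2, FunctionSpaces.Torus.gradient (ψ z.1) z.2⟫)) μT := IA.const_mul _
  have J12 : Integrable (fun z : ℝ × UnitAddTorus d =>
      2⁻¹ * (‖u z.1 z.2‖ ^ 2 * FunctionSpaces.Torus.timeDeriv ψ z.1 z.2) +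
        2⁻¹ * (‖u z.1 z.2‖ ^ 2 * ⟪u z.1 z.2, FunctionSpaces.Torus.gradient (ψ z.1) z.2⟫)) μT := J1.add J2
  simp_rw [hpt]
  rw [integral_add J12 IP, integral_add J1 J2, integral_const_mul, integral_const_mul]

end Pairings

/-! ## The identity -/

section Identity

variable {T ε : ℝ} {u : ℝ → UnitAddTorus d → EuclideanSpace ℝ d} {p : ℝ → UnitAddTorus d → ℝ}
  {ψ : ℝ → UnitAddTorus d → ℝ}

/-- **The symmetric Duchon–Robert commutator identity at scale `ε`** (De Rosa–Isett 2024, §5.1,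
the fixed-`ε` identity behind (moll_local_energy)–(eul_all_terms), in Duchon–Robert's symmetric
regularisation): for a distributional Euler solution `(u, p)` on `T^d × (0,T)` with `u ∈ L³_{t,x}`,
`p ∈ L^{3/2}_{t,x}`, the torus mollifier `K = kernel ε` (`0 < ε ≤ 1/4`) and a test function `ψ`
supported in `(0,T)`,
`2(𝓔(ψ) + 𝓔(ψ ⋆ₓ K)) = ∫∫𝒟_K(u)ψ + ∫∫ω_K ∂ₜψ + ∫∫ω_K⟪u,∇ψ⟫ + 2∫∫⟪𝒞_K, ∇ψ⟫` with
`ω_K = |u|² + |u|² ⋆ K − 2⟪u, u ⋆ K⟫` and `𝒞_K = (pu) ⋆ K + p u − p (u ⋆ K) − (p ⋆ K) u`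
(from `Torus.integral_kernelFlux_mul_eq_holds`, `Torus.symmTestField_identity_holds` and the three
pairing lemmas above). [cite: DeRosaIsett2024, §5.1 (eul_all_terms)] -/
theorem two_mul_energyFlux_add_energyFlux_mollified_eq
    (hsol : IsDistributionalNSSolutionOn T 0 0 u p)
    (hu3 : ∫⁻ t in Ioo 0 T, ∫⁻ x, ‖u t x‖ₑ ^ 3 < ⊤)
    (hp32 : ∫⁻ t in Ioo 0 T, ∫⁻ x, ‖p t x‖ₑ ^ (3 / 2 : ℝ) < ⊤)
    (hε : 0 < ε) (hε' : ε ≤ 1 / 4) (hψ : FunctionSpaces.Torus.IsSpaceTimeTestIoo T ψ) :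
    2 * (energyFluxFunctional T u p ψ + energyFluxFunctional T u p (fun t => ψ t ⋆ FunctionSpaces.Torus.kernel ε)) =
      (∫ z, kernelFlux (FunctionSpaces.Torus.kernel ε) (u z.1) z.2 * ψ z.1 z.2
          ∂((volume.restrict (Ioo 0 T)).prod volume)) +
        (∫ z, (‖u z.1 z.2‖ ^ 2 + ((fun y => ‖u z.1 y‖ ^ 2) ⋆ FunctionSpaces.Torus.kernel ε) z.2 -
            2 * ⟪u z.1 z.2, vecConv (u z.1) (FunctionSpaces.Torus.kernel ε) z.2⟫) *
            FunctionSpaces.Torus.timeDeriv ψ z.1 z.2 ∂((volume.restrict (Ioo 0 T)).prod volume)) +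
        (∫ z, (‖u z.1 z.2‖ ^ 2 + ((fun y => ‖u z.1 y‖ ^ 2) ⋆ FunctionSpaces.Torus.kernel ε) z.2 -
            2 * ⟪u z.1 z.2, vecConv (u z.1) (FunctionSpaces.Torus.kernel ε) z.2⟫) *
            ⟪u z.1 z.2, FunctionSpaces.Torus.gradient (ψ z.1) z.2⟫ ∂((volume.restrict (Ioo 0 T)).prod volume)) +
        2 * ∫ z, ⟪vecConv (fun y => p z.1 y • u z.1 y) (FunctionSpaces.Torus.kernel ε) z.2 +
              p z.1 z.2 • u z.1 z.2 - p z.1 z.2 • vecConv (u z.1) (FunctionSpaces.Torus.kernel ε) z.2 -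
              (p z.1 ⋆ FunctionSpaces.Torus.kernel ε) z.2 • u z.1 z.2,
            FunctionSpaces.Torus.gradient (ψ z.1) z.2⟫ ∂((volume.restrict (Ioo 0 T)).prod volume) := by
  set μ : Measure ℝ := volume.restrict (Ioo 0 T) with hμ
  set μT := μ.prod (volume : Measure (UnitAddTorus d)) with hμT
  have hK : FunctionSpaces.Torus.IsSmooth (FunctionSpaces.Torus.kernel (d := d) ε) :=
    FunctionSpaces.Torus.isSmooth_kernel hε hε'
  have hKev : ∀ z, FunctionSpaces.Torus.kernel (d := d) ε (-z) = FunctionSpaces.Torus.kernel ε z :=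
    FunctionSpaces.Torus.kernel_neg hε hε'
  have hum : AEStronglyMeasurable (uncurry u) μT := aestronglyMeasurable_uncurry_prod hsol.1
  have hpm : AEStronglyMeasurable (uncurry p) μT := aestronglyMeasurable_uncurry_prod hsol.2.2.1
  have hdiv : ∀ᵐ t ∂μ, FunctionSpaces.Torus.IsWeaklyDivFree (u t) := hsol.2.2.2.2.1
  -- the two Duchon–Robert identities
  have h2 := integral_kernelFlux_mul_eq_holds hsol.1 hu3 hdiv hK hKev hψ
  have h3 := symmTestField_identity_holds hsol hu3 hp32 hK hKev hψ
  -- integrability and the three pairings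
  obtain ⟨iB0, iA, iQ, iB, iE, iTm, iP1, iP2, iD⟩ := symmCommutator_integrable hum hu3 hpm hp32 hε hε' hψ
  obtain ⟨-, hdt, hgr, -⟩ := hψ.isSpaceTimeTest.isSmoothSpaceTimeOn_derived
  obtain ⟨⟨Cdt, -, hCdt⟩, hdtm⟩ := hdt.bound_and_measurable T
  obtain ⟨⟨Cgr, -, hCgr⟩, hgrm⟩ := hgr.bound_and_measurable T
  have hu3' : ∫⁻ t in Ioo 0 T, ∫⁻ x, ‖u t x‖ₑ ^ (3 : ℕ) < ⊤ := hu3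
  obtain ⟨IT, IA, IP⟩ := integrable_flux_pieces hum hu3' hpm hp32 hdtm hgrm (C := max Cdt Cgr)
    (fun t ht x => (hCdt t ht x).trans (le_max_left _ _))
    (fun t ht x => (hCgr t ht x).trans (le_max_right _ _))
  have hP := integral_mul_divergence_symmTestField_spaceTime hum hu3 hdiv hpm hp32 hε hε' hψ
  have hEK := energyFluxFunctional_mollified_eq hum hu3 hpm hp32 hε hε' hψ
  have hE := energyFluxFunctional_eq_split hum hu3 hpm hp32 hψ
  set K := FunctionSpaces.Torus.kernel (d := d) ε with hKdef
  -- iterated integrals as product integrals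
  have eA : (∫ t in Ioo 0 T, ∫ x,
      ⟪vecConv (fun y => ‖u t y‖ ^ 2 • u t y) K x, FunctionSpaces.Torus.gradient (ψ t) x⟫) =
      ∫ z, ⟪vecConv (fun y => ‖u z.1 y‖ ^ 2 • u z.1 y) K z.2, FunctionSpaces.Torus.gradient (ψ z.1) z.2⟫ ∂μT :=
    (integral_prod _ iA).symm
  have eB : (∫ t in Ioo 0 T, ∫ x,
      ((fun y => ‖u t y‖ ^ 2) ⋆ K) x * ⟪u t x, FunctionSpaces.Torus.gradient (ψ t) x⟫) =
      ∫ z, ((fun y => ‖u z.1 y‖ ^ 2) ⋆ K) z.2 * ⟪u z.1 z.2, FunctionSpaces.Torus.gradient (ψ z.1) z.2⟫ ∂μT :=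
    (integral_prod _ iB).symm
  have eE : (∫ t in Ioo 0 T, ∫ x,
      ⟪u t x, vecConv (u t) K x⟫ * ⟪u t x, FunctionSpaces.Torus.gradient (ψ t) x⟫) =
      ∫ z, ⟪u z.1 z.2, vecConv (u z.1) K z.2⟫ * ⟪u z.1 z.2, FunctionSpaces.Torus.gradient (ψ z.1) z.2⟫ ∂μT :=
    (integral_prod _ iE).symm
  have eTm : (∫ t in Ioo 0 T, ∫ x, ⟪u t x, vecConv (u t) K x⟫ * FunctionSpaces.Torus.timeDeriv ψ t x) =
      ∫ z, ⟪u z.1 z.2, vecConv (u z.1) K z.2⟫ * FunctionSpaces.Torus.timeDeriv ψ z.1 z.2 ∂μT :=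
    (integral_prod _ iTm).symm
  have eD : (∫ t in Ioo 0 T, ∫ x, kernelFlux K (u t) x * ψ t x) =
      ∫ z, kernelFlux K (u z.1) z.2 * ψ z.1 z.2 ∂μT :=
    (integral_prod _ iD).symm
  -- the three regrouped integrals
  have eω1 : (∫ z, (‖u z.1 z.2‖ ^ 2 + ((fun y => ‖u z.1 y‖ ^ 2) ⋆ K) z.2 -
        2 * ⟪u z.1 z.2, vecConv (u z.1) K z.2⟫) * FunctionSpaces.Torus.timeDeriv ψ z.1 z.2 ∂μT) =
      (∫ z, ‖u z.1 z.2‖ ^ 2 * FunctionSpaces.Torus.timeDeriv ψ z.1 z.2 ∂μT) +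
        (∫ z, ((fun y => ‖u z.1 y‖ ^ 2) ⋆ K) z.2 * FunctionSpaces.Torus.timeDeriv ψ z.1 z.2 ∂μT) -
        2 * ∫ z, ⟪u z.1 z.2, vecConv (u z.1) K z.2⟫ * FunctionSpaces.Torus.timeDeriv ψ z.1 z.2 ∂μT := by
    have I1 : Integrable (fun z : ℝ × UnitAddTorus d => ‖u z.1 z.2‖ ^ 2 * FunctionSpaces.Torus.timeDeriv ψ z.1 z.2 +
        ((fun y => ‖u z.1 y‖ ^ 2) ⋆ K) z.2 * FunctionSpaces.Torus.timeDeriv ψ z.1 z.2) μT := IT.add iB0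
    have I2 : Integrable (fun z : ℝ × UnitAddTorus d =>
        2 * (⟪u z.1 z.2, vecConv (u z.1) K z.2⟫ * FunctionSpaces.Torus.timeDeriv ψ z.1 z.2)) μT := iTm.const_mul 2
    have hfun : (fun z : ℝ × UnitAddTorus d => (‖u z.1 z.2‖ ^ 2 + ((fun y => ‖u z.1 y‖ ^ 2) ⋆ K) z.2 -
        2 * ⟪u z.1 z.2, vecConv (u z.1) K z.2⟫) * FunctionSpaces.Torus.timeDeriv ψ z.1 z.2) =
        fun z => (‖u z.1 z.2‖ ^ 2 * FunctionSpaces.Torus.timeDeriv ψ z.1 z.2 +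
          ((fun y => ‖u z.1 y‖ ^ 2) ⋆ K) z.2 * FunctionSpaces.Torus.timeDeriv ψ z.1 z.2) -
          2 * (⟪u z.1 z.2, vecConv (u z.1) K z.2⟫ * FunctionSpaces.Torus.timeDeriv ψ z.1 z.2) := by
      funext z; ring
    rw [hfun, integral_sub I1 I2, integral_add IT iB0, integral_const_mul]
  have eω2 : (∫ z, (‖u z.1 z.2‖ ^ 2 + ((fun y => ‖u z.1 y‖ ^ 2) ⋆ K) z.2 -
        2 * ⟪u z.1 z.2, vecConv (u z.1) K z.2⟫) * ⟪u z.1 z.2, FunctionSpaces.Torus.gradient (ψ z.1) z.2⟫ ∂μT) =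
      (∫ z, ‖u z.1 z.2‖ ^ 2 * ⟪u z.1 z.2, FunctionSpaces.Torus.gradient (ψ z.1) z.2⟫ ∂μT) +
        (∫ z, ((fun y => ‖u z.1 y‖ ^ 2) ⋆ K) z.2 * ⟪u z.1 z.2, FunctionSpaces.Torus.gradient (ψ z.1) z.2⟫ ∂μT) -
        2 * ∫ z, ⟪u z.1 z.2, vecConv (u z.1) K z.2⟫ * ⟪u z.1 z.2, FunctionSpaces.Torus.gradient (ψ z.1) z.2⟫ ∂μT := by
    have I1 : Integrable (fun z : ℝ × UnitAddTorus d =>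
        ‖u z.1 z.2‖ ^ 2 * ⟪u z.1 z.2, FunctionSpaces.Torus.gradient (ψ z.1) z.2⟫ +
        ((fun y => ‖u z.1 y‖ ^ 2) ⋆ K) z.2 * ⟪u z.1 z.2, FunctionSpaces.Torus.gradient (ψ z.1) z.2⟫) μT := IA.add iB
    have I2 : Integrable (fun z : ℝ × UnitAddTorus d =>
        2 * (⟪u z.1 z.2, vecConv (u z.1) K z.2⟫ * ⟪u z.1 z.2, FunctionSpaces.Torus.gradient (ψ z.1) z.2⟫)) μT :=
      iE.const_mul 2
    have hfun : (fun z : ℝ × UnitAddTorus d => (‖u z.1 z.2‖ ^ 2 + ((fun y => ‖u z.1 y‖ ^ 2) ⋆ K) z.2 -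
        2 * ⟪u z.1 z.2, vecConv (u z.1) K z.2⟫) * ⟪u z.1 z.2, FunctionSpaces.Torus.gradient (ψ z.1) z.2⟫) =
        fun z => (‖u z.1 z.2‖ ^ 2 * ⟪u z.1 z.2, FunctionSpaces.Torus.gradient (ψ z.1) z.2⟫ +
          ((fun y => ‖u z.1 y‖ ^ 2) ⋆ K) z.2 * ⟪u z.1 z.2, FunctionSpaces.Torus.gradient (ψ z.1) z.2⟫) -
          2 * (⟪u z.1 z.2, vecConv (u z.1) K z.2⟫ * ⟪u z.1 z.2, FunctionSpaces.Torus.gradient (ψ z.1) z.2⟫) := by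
      funext z; ring
    rw [hfun, integral_sub I1 I2, integral_add IA iB, integral_const_mul]
  have e𝒞 : (∫ z, ⟪vecConv (fun y => p z.1 y • u z.1 y) K z.2 + p z.1 z.2 • u z.1 z.2 -
        p z.1 z.2 • vecConv (u z.1) K z.2 - (p z.1 ⋆ K) z.2 • u z.1 z.2,
        FunctionSpaces.Torus.gradient (ψ z.1) z.2⟫ ∂μT) =
      (∫ z, ⟪vecConv (fun y => p z.1 y • u z.1 y) K z.2, FunctionSpaces.Torus.gradient (ψ z.1) z.2⟫ ∂μT) +
        (∫ z, p z.1 z.2 * ⟪u z.1 z.2, FunctionSpaces.Torus.gradient (ψ z.1) z.2⟫ ∂μT) -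
        (∫ z, p z.1 z.2 * ⟪vecConv (u z.1) K z.2, FunctionSpaces.Torus.gradient (ψ z.1) z.2⟫ ∂μT) -
        ∫ z, (p z.1 ⋆ K) z.2 * ⟪u z.1 z.2, FunctionSpaces.Torus.gradient (ψ z.1) z.2⟫ ∂μT := by
    have I1 : Integrable (fun z : ℝ × UnitAddTorus d =>
        ⟪vecConv (fun y => p z.1 y • u z.1 y) K z.2, FunctionSpaces.Torus.gradient (ψ z.1) z.2⟫ +
        p z.1 z.2 * ⟪u z.1 z.2, FunctionSpaces.Torus.gradient (ψ z.1) z.2⟫) μT := iQ.add IP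
    have I2 : Integrable (fun z : ℝ × UnitAddTorus d =>
        ⟪vecConv (fun y => p z.1 y • u z.1 y) K z.2, FunctionSpaces.Torus.gradient (ψ z.1) z.2⟫ +
        p z.1 z.2 * ⟪u z.1 z.2, FunctionSpaces.Torus.gradient (ψ z.1) z.2⟫ -
        p z.1 z.2 * ⟪vecConv (u z.1) K z.2, FunctionSpaces.Torus.gradient (ψ z.1) z.2⟫) μT := I1.sub iP1
    have hfun : (fun z : ℝ × UnitAddTorus d => ⟪vecConv (fun y => p z.1 y • u z.1 y) K z.2 + p z.1 z.2 • u z.1 z.2 -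
        p z.1 z.2 • vecConv (u z.1) K z.2 - (p z.1 ⋆ K) z.2 • u z.1 z.2,
        FunctionSpaces.Torus.gradient (ψ z.1) z.2⟫) =
        fun z => ⟪vecConv (fun y => p z.1 y • u z.1 y) K z.2, FunctionSpaces.Torus.gradient (ψ z.1) z.2⟫ +
          p z.1 z.2 * ⟪u z.1 z.2, FunctionSpaces.Torus.gradient (ψ z.1) z.2⟫ -
          p z.1 z.2 * ⟪vecConv (u z.1) K z.2, FunctionSpaces.Torus.gradient (ψ z.1) z.2⟫ -
          (p z.1 ⋆ K) z.2 * ⟪u z.1 z.2, FunctionSpaces.Torus.gradient (ψ z.1) z.2⟫ := by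
      funext z
      simp only [inner_sub_left, inner_add_left, real_inner_smul_left]
    rw [hfun, integral_sub I2 iP2, integral_sub I1 iP1, integral_add iQ IP]
  rw [eω1, eω2, e𝒞, hE, hEK]
  rw [eA, eB, eE] at h2
  rw [eTm, hP, zero_mul, add_zero] at h3
  rw [eD] at h2
  linarith [h2, h3]

end Identity

end Literature.Analysis.FluidPDE.Torus
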